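/-
Speedrun cell sr-mbsolver — LIT team (lit-1 gen-8), LEAD D-19 r118 (c) default track: lane-B transport for
`relax = mps(n, D, A)` rows ("THEOREM B" of `sr-mbsolver-lit-4/THEOREM-B.md`), PRIMAL form, spin statistics.
HONEST FRAMING: first certified bounds; not a superconductivity verdict; every number certified or labelled float.

WHAT THIS GIVES. For a lane-B `relax = mps(N, D, A)` Heisenberg row (`FORMAT-ltisdp.md` §1, §4.7; model `heisenberg(J)`,
charges `2Sᶻ`, bond charges `qb`) the two readers (verify_a ∧ verify_b, certsdp-cert/0) certify FORMAT §2 (d):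
`c·y ≥ E` for every `y = (ρ₃, ω₄, …, ω_N)` feasible for the problem with its a-priori bounds. That is the FINITE statement
  `∀ ρ₃ ω, [trace, LTI₃, 2Sᶻ-sectors, real, |·| ≤ 1 rows of ρ₃] → [rows E4L, E4R, E_mL, E_mR (m = 5..N)] →
     [ω_m ⪰ 0, sectored by the tags q(s_L) + (qb b − qb a) + q(s_R), real, |·| ≤ B_m] → E ≤ Re tr((J 𝐒₀·𝐒₁) ρ₃)`
over the SMALL variables `ρ₃ : Op (Fin 3) (n+1)` and `ω m : Matrix ([n+1] × ([D]×[D]) × [n+1]) (…) ℂ`, with the maps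
`W₂ = cgMap A 2`, `L = leftMap A`, `R = rightMap A` of `Literature/…/MPSCoarseGrainingMaps` (KSDN's, in the generator's
index conventions). `lti_claim_of_mps_claim` proves the EDGE "mps-claim ⇒ lti(N)-claim": that statement implies the
unbundled `lti(N)` node of `Transport/LTIPrimalSpinChain.lean` for the `N = m'+2`-site window, whence
`mps_primal_ringEnergy_ge` (`E · L ≤ E₀(H_L)` for every ring `L ≥ N + 1`) and `mps_primal_energyDensity_ge`
(`E ≤ heisenbergEnergyDensity n 1 J`, `J ≥ 0`) by lit-4's theorems B0. No dual object is exported; the tensor `A` is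
arbitrary (real, charge covariant) — its quality affects tightness only, never soundness.

PROOF (= FORMAT-ltisdp §2 (b)(c); KSDN arXiv:2212.03014 §4.2: "these satisfy (arrowDiagram) due to (MPSextension) and the
conditions `ρ_{1..m} = ρ_{2..m+1}`"). Given a window variable `ρ = ρ_N` feasible for the `lti(N)` node put `ρ_m := ρ|_{first m}`
(`headMarginal`), `ρ₃ := ρ_3`, `ω_m := C_{m-2}(ρ_m) = (𝟙 ⊗ W_{m-2} ⊗ 𝟙) ρ_m (…)ᴴ` (`cgState`). Rows: LTI descends to every head
marginal (`lti_headMarginal`); E4L/E4R/E_mL/E_mR = `traceLeft_cgState`, `traceRight_cgState_submatrix_prodAssoc`,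
`traceLeft_cgState_headMarginal`, `traceRight_cgState_headMarginal`; `ω_m ⪰ 0` = `posSemidef_cgState`; `|ω_m| ≤ B_m` from
`‖T^{m-2}‖_F² ≤ B_m²` = `norm_cgState_apply_le_of_transferOp`; sectors = `cgState_apply_eq_zero_of_cgTag_ne` (the `2Sᶻ` sectors of
`ρ_m` are inherited from `ρ`, `spinPartialTrace_apply_eq_zero_of_charge`); realness = `star_cgState_apply`,
`star_headMarginal_apply`; and `tr((J 𝐒₀·𝐒₁) ρ₃) = tr((J 𝐒₀·𝐒₁) ρ)` (`trace_mul_spinPartialTrace`, `spinEmbed_spinDot`).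
[cite: KullEtAl2024, §2.3–2.5 eqs. (TNoneStepRelaxation), (TNfullRelax5); §4.2 eqs. (MPSextension), (relaxLocTIn)]
[cite: Tasaki2020, §2.1, §2.4–2.5]
-/
import Summits.Ventures.CertifiedManyBodySolver.Transport.LTIPrimalSpinChain
import Literature.MathematicalPhysics.QuantumLattice.MPSCoarseGrainingReal
import Literature.MathematicalPhysics.QuantumLattice.MPSCoarseGrainingSectors
import Literature.MathematicalPhysics.QuantumLattice.MPSTransferMatrix
import HarnessLib

noncomputable section

open Matrix Complex Filter Topology
open scoped ComplexOrder Kronecker BigOperators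
open Literature.Probability.LatticeModels
open Literature.MathematicalPhysics.QuantumLattice
open Literature.MathematicalPhysics.QuantumLattice.MPSCoarseGraining
open Literature.Computability.QuantumComplexity (traceLeft traceRight)

namespace Summit.Ventures.CertifiedManyBodySolver.Transport

/-! ### Charge sectors are inherited by marginals (generic additive site charges) -/

section Charges

variable {X Y G : Type*} [Fintype X] [DecidableEq X] [Fintype Y] [DecidableEq Y] [AddCancelCommMonoid G] {q : ℕ}

omit [DecidableEq X] [DecidableEq Y] in
/-- Two configurations that agree off the range of `φ` have total charges that differ exactly by the charges read through
`φ`: `Q(u) + Q(v ∘ φ) = Q(v) + Q(u ∘ φ)`. [folklore] -/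
theorem sum_charge_add_eq_of_agree (c : Fin q → G) (φ : X ↪ Y) {u v : TensorIndex Y q}
    (h : ∀ y, y ∉ Set.range φ → u y = v y) :
    (∑ y, c (u y)) + ∑ x, c (v (φ x)) = (∑ y, c (v y)) + ∑ x, c (u (φ x)) := by
  classical
  have split : ∀ w : TensorIndex Y q, ∑ y, c (w y) =
      (∑ x, c (w (φ x))) + ∑ y ∈ Finset.univ.filter (fun y => y ∉ Set.range φ), c (w y) := by
    intro w
    rw [← Finset.sum_filter_add_sum_filter_not Finset.univ (fun y => y ∈ Set.range φ)]
    congr 1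
    have hset : Finset.univ.filter (fun y => y ∈ Set.range φ) = Finset.univ.map φ := by
      ext y
      simp only [Finset.mem_filter, Finset.mem_univ, true_and, Finset.mem_map, Set.mem_range]
    rw [hset, Finset.sum_map]
  have hoff : ∑ y ∈ Finset.univ.filter (fun y => y ∉ Set.range φ), c (u y) =
      ∑ y ∈ Finset.univ.filter (fun y => y ∉ Set.range φ), c (v y) :=
    Finset.sum_congr rfl fun y hy => by rw [h y (Finset.mem_filter.1 hy).2]
  rw [split u, split v, hoff]
  abel

/-- **Sector zeros are inherited by marginals.** If `σ ∈ 𝔄_Y` vanishes between product-basis configurations of different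
total charge `Q = Σ_y c(·_y)` (block diagonal in the charge), so does every partial trace `tr_φ σ` for the charge summed
over `X` (the traced-out sites carry the same configuration on both sides). [cite: KullEtAl2024, §3.3 (symmetry sectors of the
window variables)] -/
theorem spinPartialTrace_apply_eq_zero_of_charge (c : Fin q → G) (φ : X ↪ Y) {σ : Op Y q}
    (hσ : ∀ u v : TensorIndex Y q, (∑ y, c (u y)) ≠ (∑ y, c (v y)) → σ u v = 0) {t s : TensorIndex X q}
    (hts : (∑ x, c (t x)) ≠ (∑ x, c (s x))) : spinPartialTrace φ σ t s = 0 := by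
  rw [spinPartialTrace_apply, Matrix.trace]
  refine Finset.sum_eq_zero fun a _ => ?_
  rw [Matrix.diag_apply, Matrix.mul_apply]
  refine Finset.sum_eq_zero fun b _ => ?_
  rw [spinEmbed_apply]
  split_ifs with hab
  · rw [Matrix.single_apply]
    split_ifs with hst
    · obtain ⟨h1, h2⟩ := hst
      have hzero : σ b a = 0 := by
        refine hσ b a fun hba => hts ?_
        have key := sum_charge_add_eq_of_agree c φ hab
        rw [hba] at key
        have key' := add_left_cancel key
        rw [h1, h2]
        exact key'
      rw [hzero, mul_zero]
    · rw [zero_mul]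
  · rw [zero_mul]

/-- Head marginals inherit the charge sectors. [cite: KullEtAl2024, §3.3] -/
theorem headMarginal_apply_eq_zero_of_charge (c : Fin q → G) {N m : ℕ} (h : m ≤ N) {ρ : Op (Fin N) q}
    (hρ : ∀ u v : TensorIndex (Fin N) q, (∑ y, c (u y)) ≠ (∑ y, c (v y)) → ρ u v = 0) {t s : TensorIndex (Fin m) q}
    (hts : (∑ x, c (t x)) ≠ (∑ x, c (s x))) : headMarginal h ρ t s = 0 :=
  spinPartialTrace_apply_eq_zero_of_charge c (Fin.castLEEmb h) hρ hts

/-- Equal `Σ_x s_x` gives equal total `2Sᶻ = Σ_x (n − 2 s_x)` (the FORMAT-ltisdp charge `q(s) = 2Sᶻ(s)` of a spin-`n/2`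
configuration versus the `Σ s_x` form of the `lti(m)` node). [cite: KullEtAl2024, §3.3] -/
theorem sum_twoSz_eq_of_sum_val_eq {m : ℕ} (n : ℕ) {u v : TensorIndex (Fin m) (n + 1)}
    (h : (∑ x, (u x : ℕ)) = (∑ x, (v x : ℕ))) :
    (∑ x, ((n : ℤ) - 2 * ((u x : ℕ) : ℤ))) = ∑ x, ((n : ℤ) - 2 * ((v x : ℕ) : ℤ)) := by
  have h' : (∑ x, ((u x : ℕ) : ℤ)) = ∑ x, ((v x : ℕ) : ℤ) := by exact_mod_cast h
  simp only [Finset.sum_sub_distrib, ← Finset.mul_sum, h']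

end Charges

/-! ### THEOREM B, spin chain: the `mps(N, D, A)` statement implies the `lti(N)` statement -/

section Transport

variable {β : Type*} [Fintype β] [DecidableEq β]

/-- **THEOREM B (edge form): the primal `mps(N, D, A)` statement implies the primal `lti(N)` statement.**
Data: spin `n/2` (local dimension `n+1`), window `N = m'+2 ≥ 4` sites, a REAL MPS tensor `A = (A^s)_s` on the bond index
type `β` (`star A^s_{ab} = A^s_{ab}`) that is CHARGE COVARIANT for `2Sᶻ` (`A^s_{ab} ≠ 0 ⇒ qb b = qb a + (n − 2s)`, the
generator's check of FORMAT-ltisdp §4.3/§4.12), and a-priori bounds `B_m ≥ 0` with `‖T^{m−2}‖_F² ≤ B_m²`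
(`T = Σ_s A^s ⊗ conj A^s`, FORMAT §1 "B_m ≥ ‖T^{m−2}‖_F"). HYPOTHESIS `hclaim` = the by-value node of an `mps` row, i.e.
FORMAT §1/§4.7 verbatim over `(ρ₃, ω₄, …, ω_N)`: `ρ₃ ⪰ 0`, `tr ρ₃ = 1`, LTI₃ `tr_L ρ₃ = tr_R ρ₃`, `2Sᶻ`-sector zeros
(`Σ s_x` form), real entries, `|ρ₃| ≤ 1`; E4L `tr_{s_L} ω₄ = (W₂ ⊗ 𝟙) ρ₃ (W₂ ⊗ 𝟙)ᴴ` (`ρ₃` read as (first two sites, last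
site)), E4R `tr_{s_R} ω₄ = (𝟙 ⊗ W₂) ρ₃ (𝟙 ⊗ W₂)ᴴ` (read as (first site, last two)), E_mL `tr_{s_L} ω_m = (L ⊗ 𝟙) ω_{m−1} (L ⊗ 𝟙)ᴴ`
and E_mR `tr_{s_R} ω_m = (𝟙 ⊗ R) ω_{m−1} (𝟙 ⊗ R)ᴴ` for `m = k+5 ≤ N`; `ω_m ⪰ 0`, sector zeros for the tags
`q(s_L) + (qb b − qb a) + q(s_R)` (`cgTag`, FORMAT §4.3), real entries, `|ω_m| ≤ B_m` (`m = k+4 ≤ N`); conclusion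
`E ≤ Re tr((J 𝐒₀·𝐒₁) ρ₃)`. CONCLUSION: the `hclaim` of `lti_primal_ringEnergy_ge` / `lti_primal_energyDensity_ge` for the
`N`-site window. Proof: the feasible point `ρ₃ = ρ|₃`, `ω_m = C_{m−2}(ρ|_m)` of KSDN §4.2.
[cite: KullEtAl2024, §2.3–2.5, §4.2 eqs. (MPSextension), (relaxLocTIn)] -/
theorem lti_claim_of_mps_claim (n m' : ℕ) (hm' : 2 ≤ m') (J : ℝ) (A : Fin (n + 1) → Matrix β β ℂ)
    (hAreal : ∀ s a b, star (A s a b) = A s a b) (qb : β → ℤ)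
    (hAcov : ∀ s a b, A s a b ≠ 0 → qb b = qb a + ((n : ℤ) - 2 * ((s : ℕ) : ℤ)))
    (B : ℕ → ℝ) (hB : ∀ k, k + 4 ≤ m' + 2 → 0 ≤ B (k + 4) ∧ frobSq (transferOp A ^ (k + 2)) ≤ B (k + 4) ^ 2)
    {E : ℝ}
    (hclaim : ∀ (ρ₃ : Op (Fin 3) (n + 1))
        (ω : ℕ → Matrix (Fin (n + 1) × ((β × β) × Fin (n + 1))) (Fin (n + 1) × ((β × β) × Fin (n + 1))) ℂ),
      ρ₃.PosSemidef → ρ₃.trace = 1 →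
      spinPartialTrace (Fin.succEmb 2) ρ₃ = spinPartialTrace Fin.castSuccEmb ρ₃ →
      (∀ t s : TensorIndex (Fin 3) (n + 1), (∑ x, (t x : ℕ)) ≠ (∑ x, (s x : ℕ)) → ρ₃ t s = 0) →
      (∀ t s : TensorIndex (Fin 3) (n + 1), starRingEnd ℂ (ρ₃ t s) = ρ₃ t s) →
      (∀ t s : TensorIndex (Fin 3) (n + 1), ‖ρ₃ t s‖ ≤ 1) →
      traceLeft (ω 4) = (cgMap A 2 ⊗ₖ (1 : Matrix (Fin (n + 1)) (Fin (n + 1)) ℂ)) *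
          ρ₃.submatrix ((Equiv.prodComm _ _).trans (Fin.snocEquiv fun _ => Fin (n + 1)))
            ((Equiv.prodComm _ _).trans (Fin.snocEquiv fun _ => Fin (n + 1))) *
        (cgMap A 2 ⊗ₖ (1 : Matrix (Fin (n + 1)) (Fin (n + 1)) ℂ))ᴴ →
      traceRight ((ω 4).submatrix (Equiv.prodAssoc _ _ _) (Equiv.prodAssoc _ _ _)) =
        ((1 : Matrix (Fin (n + 1)) (Fin (n + 1)) ℂ) ⊗ₖ cgMap A 2) *
          ρ₃.submatrix (Fin.consEquiv fun _ => Fin (n + 1)) (Fin.consEquiv fun _ => Fin (n + 1)) *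
        ((1 : Matrix (Fin (n + 1)) (Fin (n + 1)) ℂ) ⊗ₖ cgMap A 2)ᴴ →
      (∀ k, k + 5 ≤ m' + 2 → traceLeft (ω (k + 5)) =
        (leftMap A ⊗ₖ (1 : Matrix (Fin (n + 1)) (Fin (n + 1)) ℂ)) *
          (ω (k + 4)).submatrix (Equiv.prodAssoc _ _ _) (Equiv.prodAssoc _ _ _) *
        (leftMap A ⊗ₖ (1 : Matrix (Fin (n + 1)) (Fin (n + 1)) ℂ))ᴴ) →
      (∀ k, k + 5 ≤ m' + 2 → traceRight ((ω (k + 5)).submatrix (Equiv.prodAssoc _ _ _) (Equiv.prodAssoc _ _ _)) =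
        ((1 : Matrix (Fin (n + 1)) (Fin (n + 1)) ℂ) ⊗ₖ rightMap A) * ω (k + 4) *
        ((1 : Matrix (Fin (n + 1)) (Fin (n + 1)) ℂ) ⊗ₖ rightMap A)ᴴ) →
      (∀ k, k + 4 ≤ m' + 2 → (ω (k + 4)).PosSemidef) →
      (∀ k, k + 4 ≤ m' + 2 → ∀ i j, cgTag (fun s : Fin (n + 1) => (n : ℤ) - 2 * ((s : ℕ) : ℤ)) qb i ≠
          cgTag (fun s : Fin (n + 1) => (n : ℤ) - 2 * ((s : ℕ) : ℤ)) qb j → ω (k + 4) i j = 0) →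
      (∀ k, k + 4 ≤ m' + 2 → ∀ i j, starRingEnd ℂ (ω (k + 4) i j) = ω (k + 4) i j) →
      (∀ k, k + 4 ≤ m' + 2 → ∀ i j, ‖ω (k + 4) i j‖ ≤ B (k + 4)) →
      E ≤ ((((J : ℂ) • spinDot n (0 : Fin 3) 1) * ρ₃).trace).re)
    (ρ : Op (Fin (m' + 2)) (n + 1)) (hpsd : ρ.PosSemidef) (htr : ρ.trace = 1)
    (hLTI : spinPartialTrace (Fin.succEmb (m' + 1)) ρ = spinPartialTrace Fin.castSuccEmb ρ)
    (hsec : ∀ t s : TensorIndex (Fin (m' + 2)) (n + 1), (∑ x, (t x : ℕ)) ≠ (∑ x, (s x : ℕ)) → ρ t s = 0)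
    (hreal : ∀ t s : TensorIndex (Fin (m' + 2)) (n + 1), starRingEnd ℂ (ρ t s) = ρ t s)
    (_hbd : ∀ t s : TensorIndex (Fin (m' + 2)) (n + 1), ‖ρ t s‖ ≤ 1) :
    E ≤ ((((J : ℂ) • spinDot n (0 : Fin (m' + 2)) 1) * ρ).trace).re := by
  classical
  -- realness of `ρ` in `star` form
  have hρstar : ∀ u v, star (ρ u v) = ρ u v := fun u v => by
    have := hreal u v
    rwa [starRingEnd_apply] at this
  have h3 : 3 ≤ m' + 2 := by omega
  have h4 : 4 ≤ m' + 2 := by omega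
  -- the head marginals `ρ_m = ρ|_{first m}`: states, real, sectored
  have hHpsd : ∀ {m} (h : m ≤ m' + 2), (headMarginal h ρ).PosSemidef := fun h => posSemidef_headMarginal h hpsd
  have hHtr : ∀ {m} (h : m ≤ m' + 2), (headMarginal h ρ).trace = 1 := fun h => by rw [trace_headMarginal, htr]
  have hHstar : ∀ {m} (h : m ≤ m' + 2) (t s : TensorIndex (Fin m) (n + 1)),
      star (headMarginal h ρ t s) = headMarginal h ρ t s := fun h t s => star_headMarginal_apply hρstar h t s
  have hHsecN : ∀ {m} (h : m ≤ m' + 2) (t s : TensorIndex (Fin m) (n + 1)),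
      (∑ x, (t x : ℕ)) ≠ (∑ x, (s x : ℕ)) → headMarginal h ρ t s = 0 := fun h t s hts =>
    headMarginal_apply_eq_zero_of_charge (fun a : Fin (n + 1) => (a : ℕ)) h hsec hts
  have hHsecZ : ∀ {m} (h : m ≤ m' + 2) (u v : TensorIndex (Fin m) (n + 1)),
      (∑ x, (fun s : Fin (n + 1) => (n : ℤ) - 2 * ((s : ℕ) : ℤ)) (u x)) ≠
        (∑ x, (fun s : Fin (n + 1) => (n : ℤ) - 2 * ((s : ℕ) : ℤ)) (v x)) → headMarginal h ρ u v = 0 := by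
    intro m h u v huv
    by_cases hN : (∑ x, (u x : ℕ)) = (∑ x, (v x : ℕ))
    · exact absurd (sum_twoSz_eq_of_sum_val_eq n hN) huv
    · exact hHsecN h u v hN
  -- the feasible point: `ρ₃ = ρ|₃` and `ω_m = C_{m-2}(ρ|_m)` (`4 ≤ m ≤ N`), zero elsewhere
  set ρ₃ : Op (Fin 3) (n + 1) := headMarginal h3 ρ with hρ₃def
  set ω : ℕ → Matrix (Fin (n + 1) × ((β × β) × Fin (n + 1))) (Fin (n + 1) × ((β × β) × Fin (n + 1))) ℂ :=
    fun m => if h : 4 ≤ m ∧ m ≤ m' + 2 then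
      cgState A (m - 4 + 2) (headMarginal (show m - 4 + 2 + 2 ≤ m' + 2 by omega) ρ) else 0 with hωdef
  have hω4' : ω 4 = cgState A 2 (headMarginal h4 ρ) :=
    dif_pos (show 4 ≤ 4 ∧ 4 ≤ m' + 2 from ⟨le_rfl, h4⟩)
  have hω4 : ∀ k (hk : k + 4 ≤ m' + 2), ω (k + 4) = cgState A (k + 2) (headMarginal hk ρ) := fun k hk =>
    dif_pos (show 4 ≤ k + 4 ∧ k + 4 ≤ m' + 2 from ⟨by omega, hk⟩)
  have hω5 : ∀ k (hk : k + 5 ≤ m' + 2), ω (k + 5) = cgState A (k + 3) (headMarginal hk ρ) := fun k hk =>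
    dif_pos (show 4 ≤ k + 5 ∧ k + 5 ≤ m' + 2 from ⟨by omega, hk⟩)
  -- rows of `ρ₃`
  have hLTI3 : spinPartialTrace (Fin.succEmb 2) ρ₃ = spinPartialTrace Fin.castSuccEmb ρ₃ :=
    lti_headMarginal hLTI (show 2 ≤ m' + 1 by omega)
  have hreal3 : ∀ t s : TensorIndex (Fin 3) (n + 1), starRingEnd ℂ (ρ₃ t s) = ρ₃ t s := fun t s => by
    rw [starRingEnd_apply]
    exact hHstar h3 t s
  have hbd3 : ∀ t s : TensorIndex (Fin 3) (n + 1), ‖ρ₃ t s‖ ≤ 1 :=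
    norm_apply_le_one_of_posSemidef (hHpsd h3) (hHtr h3)
  -- rows of `ω_m`, `m = k + 4`
  have hωpsd : ∀ k, k + 4 ≤ m' + 2 → (ω (k + 4)).PosSemidef := fun k hk => by
    rw [hω4 k hk]
    exact posSemidef_cgState A (k + 2) (hHpsd hk)
  have hωsec : ∀ k, k + 4 ≤ m' + 2 → ∀ i j, cgTag (fun s : Fin (n + 1) => (n : ℤ) - 2 * ((s : ℕ) : ℤ)) qb i ≠
      cgTag (fun s : Fin (n + 1) => (n : ℤ) - 2 * ((s : ℕ) : ℤ)) qb j → ω (k + 4) i j = 0 := fun k hk i j hij => by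
    rw [hω4 k hk]
    exact cgState_apply_eq_zero_of_cgTag_ne (qs := fun s : Fin (n + 1) => (n : ℤ) - 2 * ((s : ℕ) : ℤ))
      hAcov (k + 2) (hHsecZ hk) i j hij
  have hωreal : ∀ k, k + 4 ≤ m' + 2 → ∀ i j, starRingEnd ℂ (ω (k + 4) i j) = ω (k + 4) i j := fun k hk i j => by
    rw [hω4 k hk, starRingEnd_apply]
    exact star_cgState_apply hAreal (k + 2) (hHstar hk) i j
  have hωbd : ∀ k, k + 4 ≤ m' + 2 → ∀ i j, ‖ω (k + 4) i j‖ ≤ B (k + 4) := fun k hk i j => by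
    rw [hω4 k hk]
    exact norm_cgState_apply_le_of_transferOp A (k + 2) (hHpsd hk) (hHtr hk) (hB k hk).1 (hB k hk).2 i j
  -- rows E4L / E4R (`ρ₃ = tr_L ρ₄ = tr_R ρ₄`)
  have hE4L : traceLeft (ω 4) = (cgMap A 2 ⊗ₖ (1 : Matrix (Fin (n + 1)) (Fin (n + 1)) ℂ)) *
      ρ₃.submatrix ((Equiv.prodComm _ _).trans (Fin.snocEquiv fun _ => Fin (n + 1)))
        ((Equiv.prodComm _ _).trans (Fin.snocEquiv fun _ => Fin (n + 1))) *
      (cgMap A 2 ⊗ₖ (1 : Matrix (Fin (n + 1)) (Fin (n + 1)) ℂ))ᴴ := by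
    have e2 : spinPartialTrace (Fin.succEmb 3) (headMarginal h4 ρ) = ρ₃ :=
      spinPartialTrace_succEmb_headMarginal hLTI (show 3 ≤ m' + 1 by omega)
    calc traceLeft (ω 4) = traceLeft (cgState A 2 (headMarginal h4 ρ)) := by rw [hω4']
      _ = (cgMap A 2 ⊗ₖ (1 : Matrix (Fin (n + 1)) (Fin (n + 1)) ℂ)) *
            (spinPartialTrace (Fin.succEmb 3) (headMarginal h4 ρ)).submatrix
              ((Equiv.prodComm _ _).trans (Fin.snocEquiv fun _ => Fin (n + 1)))
              ((Equiv.prodComm _ _).trans (Fin.snocEquiv fun _ => Fin (n + 1))) *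
          (cgMap A 2 ⊗ₖ (1 : Matrix (Fin (n + 1)) (Fin (n + 1)) ℂ))ᴴ := traceLeft_cgState A 2 _
      _ = _ := by rw [e2]
  have hE4R : traceRight ((ω 4).submatrix (Equiv.prodAssoc _ _ _) (Equiv.prodAssoc _ _ _)) =
      ((1 : Matrix (Fin (n + 1)) (Fin (n + 1)) ℂ) ⊗ₖ cgMap A 2) *
        ρ₃.submatrix (Fin.consEquiv fun _ => Fin (n + 1)) (Fin.consEquiv fun _ => Fin (n + 1)) *
      ((1 : Matrix (Fin (n + 1)) (Fin (n + 1)) ℂ) ⊗ₖ cgMap A 2)ᴴ := by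
    have e2 : spinPartialTrace Fin.castSuccEmb (headMarginal h4 ρ) = ρ₃ :=
      spinPartialTrace_castSuccEmb_headMarginal h4 ρ
    calc traceRight ((ω 4).submatrix (Equiv.prodAssoc _ _ _) (Equiv.prodAssoc _ _ _))
        = traceRight ((cgState A 2 (headMarginal h4 ρ)).submatrix (Equiv.prodAssoc _ _ _) (Equiv.prodAssoc _ _ _)) := by
          rw [hω4']
      _ = ((1 : Matrix (Fin (n + 1)) (Fin (n + 1)) ℂ) ⊗ₖ cgMap A 2) *
            (spinPartialTrace Fin.castSuccEmb (headMarginal h4 ρ)).submatrix (Fin.consEquiv fun _ => Fin (n + 1))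
              (Fin.consEquiv fun _ => Fin (n + 1)) *
          ((1 : Matrix (Fin (n + 1)) (Fin (n + 1)) ℂ) ⊗ₖ cgMap A 2)ᴴ := traceRight_cgState_submatrix_prodAssoc A 2 _
      _ = _ := by rw [e2]
  -- rows E_mL / E_mR, `m = k + 5`
  have hEmL : ∀ k, k + 5 ≤ m' + 2 → traceLeft (ω (k + 5)) =
      (leftMap A ⊗ₖ (1 : Matrix (Fin (n + 1)) (Fin (n + 1)) ℂ)) *
        (ω (k + 4)).submatrix (Equiv.prodAssoc _ _ _) (Equiv.prodAssoc _ _ _) *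
      (leftMap A ⊗ₖ (1 : Matrix (Fin (n + 1)) (Fin (n + 1)) ℂ))ᴴ := by
    intro k hk5
    have hk4 : k + 4 ≤ m' + 2 := by omega
    have hkM : k + 2 + 2 ≤ m' + 1 := by omega
    rw [hω5 k hk5, hω4 k hk4]
    exact traceLeft_cgState_headMarginal A (k + 2) hLTI hkM
  have hEmR : ∀ k, k + 5 ≤ m' + 2 → traceRight ((ω (k + 5)).submatrix (Equiv.prodAssoc _ _ _) (Equiv.prodAssoc _ _ _)) =
      ((1 : Matrix (Fin (n + 1)) (Fin (n + 1)) ℂ) ⊗ₖ rightMap A) * ω (k + 4) *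
      ((1 : Matrix (Fin (n + 1)) (Fin (n + 1)) ℂ) ⊗ₖ rightMap A)ᴴ := by
    intro k hk5
    have hk4 : k + 4 ≤ m' + 2 := by omega
    have hkM : k + 2 + 2 ≤ m' + 1 := by omega
    rw [hω5 k hk5, hω4 k hk4]
    exact traceRight_cgState_headMarginal A (k + 2) ρ hkM
  -- the objective: `tr((J 𝐒₀·𝐒₁) ρ₃) = tr((J 𝐒₀·𝐒₁) ρ)`
  have e0 : Fin.castLEEmb h3 (0 : Fin 3) = (0 : Fin (m' + 2)) := Fin.ext rfl
  have e1 : Fin.castLEEmb h3 (1 : Fin 3) = (1 : Fin (m' + 2)) := Fin.ext rfl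
  have hobj : (((J : ℂ) • spinDot n (0 : Fin 3) 1) * ρ₃).trace =
      (((J : ℂ) • spinDot n (0 : Fin (m' + 2)) 1) * ρ).trace := by
    rw [hρ₃def, headMarginal, trace_mul_spinPartialTrace, map_smul, spinEmbed_spinDot, e0, e1]
  -- apply the claim at the feasible point
  have hE := hclaim ρ₃ ω (hHpsd h3) (hHtr h3) hLTI3 (hHsecN h3) hreal3 hbd3 hE4L hE4R hEmL hEmR hωpsd hωsec hωreal hωbd
  rwa [hobj] at hE

variable {L : ℕ} [NeZero L]

/-- **THEOREM B (ring form): the primal `mps(N, D, A)` statement bounds every ring.** Under the by-value `mps` node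
(`hclaim`, as in `lti_claim_of_mps_claim`) for the `N = m'+2`-site window: `E · L ≤ E₀(H_L)` for every ring `ℤ/Lℤ` with
`L ≥ N + 1`, `H_L = J Σ 𝐒_x·𝐒_{x+1}`. [cite: KullEtAl2024, §2.5 eq. (TNfullRelax5), §4.2, §6.2] [cite: Tasaki2020, §2.1, §2.4–2.5] -/
theorem mps_primal_ringEnergy_ge (n m' : ℕ) (hm' : 2 ≤ m') (J : ℝ) (hL : m' + 3 ≤ L) (A : Fin (n + 1) → Matrix β β ℂ)
    (hAreal : ∀ s a b, star (A s a b) = A s a b) (qb : β → ℤ)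
    (hAcov : ∀ s a b, A s a b ≠ 0 → qb b = qb a + ((n : ℤ) - 2 * ((s : ℕ) : ℤ)))
    (B : ℕ → ℝ) (hB : ∀ k, k + 4 ≤ m' + 2 → 0 ≤ B (k + 4) ∧ frobSq (transferOp A ^ (k + 2)) ≤ B (k + 4) ^ 2)
    {E : ℝ}
    (hclaim : ∀ (ρ₃ : Op (Fin 3) (n + 1))
        (ω : ℕ → Matrix (Fin (n + 1) × ((β × β) × Fin (n + 1))) (Fin (n + 1) × ((β × β) × Fin (n + 1))) ℂ),
      ρ₃.PosSemidef → ρ₃.trace = 1 →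
      spinPartialTrace (Fin.succEmb 2) ρ₃ = spinPartialTrace Fin.castSuccEmb ρ₃ →
      (∀ t s : TensorIndex (Fin 3) (n + 1), (∑ x, (t x : ℕ)) ≠ (∑ x, (s x : ℕ)) → ρ₃ t s = 0) →
      (∀ t s : TensorIndex (Fin 3) (n + 1), starRingEnd ℂ (ρ₃ t s) = ρ₃ t s) →
      (∀ t s : TensorIndex (Fin 3) (n + 1), ‖ρ₃ t s‖ ≤ 1) →
      traceLeft (ω 4) = (cgMap A 2 ⊗ₖ (1 : Matrix (Fin (n + 1)) (Fin (n + 1)) ℂ)) *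
          ρ₃.submatrix ((Equiv.prodComm _ _).trans (Fin.snocEquiv fun _ => Fin (n + 1)))
            ((Equiv.prodComm _ _).trans (Fin.snocEquiv fun _ => Fin (n + 1))) *
        (cgMap A 2 ⊗ₖ (1 : Matrix (Fin (n + 1)) (Fin (n + 1)) ℂ))ᴴ →
      traceRight ((ω 4).submatrix (Equiv.prodAssoc _ _ _) (Equiv.prodAssoc _ _ _)) =
        ((1 : Matrix (Fin (n + 1)) (Fin (n + 1)) ℂ) ⊗ₖ cgMap A 2) *
          ρ₃.submatrix (Fin.consEquiv fun _ => Fin (n + 1)) (Fin.consEquiv fun _ => Fin (n + 1)) *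
        ((1 : Matrix (Fin (n + 1)) (Fin (n + 1)) ℂ) ⊗ₖ cgMap A 2)ᴴ →
      (∀ k, k + 5 ≤ m' + 2 → traceLeft (ω (k + 5)) =
        (leftMap A ⊗ₖ (1 : Matrix (Fin (n + 1)) (Fin (n + 1)) ℂ)) *
          (ω (k + 4)).submatrix (Equiv.prodAssoc _ _ _) (Equiv.prodAssoc _ _ _) *
        (leftMap A ⊗ₖ (1 : Matrix (Fin (n + 1)) (Fin (n + 1)) ℂ))ᴴ) →
      (∀ k, k + 5 ≤ m' + 2 → traceRight ((ω (k + 5)).submatrix (Equiv.prodAssoc _ _ _) (Equiv.prodAssoc _ _ _)) =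
        ((1 : Matrix (Fin (n + 1)) (Fin (n + 1)) ℂ) ⊗ₖ rightMap A) * ω (k + 4) *
        ((1 : Matrix (Fin (n + 1)) (Fin (n + 1)) ℂ) ⊗ₖ rightMap A)ᴴ) →
      (∀ k, k + 4 ≤ m' + 2 → (ω (k + 4)).PosSemidef) →
      (∀ k, k + 4 ≤ m' + 2 → ∀ i j, cgTag (fun s : Fin (n + 1) => (n : ℤ) - 2 * ((s : ℕ) : ℤ)) qb i ≠
          cgTag (fun s : Fin (n + 1) => (n : ℤ) - 2 * ((s : ℕ) : ℤ)) qb j → ω (k + 4) i j = 0) →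
      (∀ k, k + 4 ≤ m' + 2 → ∀ i j, starRingEnd ℂ (ω (k + 4) i j) = ω (k + 4) i j) →
      (∀ k, k + 4 ≤ m' + 2 → ∀ i j, ‖ω (k + 4) i j‖ ≤ B (k + 4)) →
      E ≤ ((((J : ℂ) • spinDot n (0 : Fin 3) 1) * ρ₃).trace).re) :
    E * L ≤ (heisenbergHamiltonian n (torusGraph 1 L) J).groundEnergy :=
  lti_primal_ringEnergy_ge n m' J hL fun ρ h1 h2 h3 h4 h5 h6 =>
    lti_claim_of_mps_claim n m' hm' J A hAreal qb hAcov B hB hclaim ρ h1 h2 h3 h4 h5 h6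

omit [NeZero L] in
/-- **THEOREM B (thermodynamic limit).** Under the same by-value `mps(N, D, A)` node and `J ≥ 0`:
`E ≤ heisenbergEnergyDensity n 1 J` — the lane-B `relax = mps` Heisenberg certificate transported BY NAME to the infinite
chain (FORMAT-ltisdp §2: "THEOREM. For every TI state ω of the chain: ω(h₁₂) ≥ claimed.bound").
[cite: KullEtAl2024, §2.5 eq. (TNfullRelax5), §4.2, §6.2] [cite: Ruelle1969, §2.2] -/
theorem mps_primal_energyDensity_ge (n m' : ℕ) (hm' : 2 ≤ m') {J : ℝ} (hJ : 0 ≤ J) (A : Fin (n + 1) → Matrix β β ℂ)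
    (hAreal : ∀ s a b, star (A s a b) = A s a b) (qb : β → ℤ)
    (hAcov : ∀ s a b, A s a b ≠ 0 → qb b = qb a + ((n : ℤ) - 2 * ((s : ℕ) : ℤ)))
    (B : ℕ → ℝ) (hB : ∀ k, k + 4 ≤ m' + 2 → 0 ≤ B (k + 4) ∧ frobSq (transferOp A ^ (k + 2)) ≤ B (k + 4) ^ 2)
    {E : ℝ}
    (hclaim : ∀ (ρ₃ : Op (Fin 3) (n + 1))
        (ω : ℕ → Matrix (Fin (n + 1) × ((β × β) × Fin (n + 1))) (Fin (n + 1) × ((β × β) × Fin (n + 1))) ℂ),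
      ρ₃.PosSemidef → ρ₃.trace = 1 →
      spinPartialTrace (Fin.succEmb 2) ρ₃ = spinPartialTrace Fin.castSuccEmb ρ₃ →
      (∀ t s : TensorIndex (Fin 3) (n + 1), (∑ x, (t x : ℕ)) ≠ (∑ x, (s x : ℕ)) → ρ₃ t s = 0) →
      (∀ t s : TensorIndex (Fin 3) (n + 1), starRingEnd ℂ (ρ₃ t s) = ρ₃ t s) →
      (∀ t s : TensorIndex (Fin 3) (n + 1), ‖ρ₃ t s‖ ≤ 1) →
      traceLeft (ω 4) = (cgMap A 2 ⊗ₖ (1 : Matrix (Fin (n + 1)) (Fin (n + 1)) ℂ)) *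
          ρ₃.submatrix ((Equiv.prodComm _ _).trans (Fin.snocEquiv fun _ => Fin (n + 1)))
            ((Equiv.prodComm _ _).trans (Fin.snocEquiv fun _ => Fin (n + 1))) *
        (cgMap A 2 ⊗ₖ (1 : Matrix (Fin (n + 1)) (Fin (n + 1)) ℂ))ᴴ →
      traceRight ((ω 4).submatrix (Equiv.prodAssoc _ _ _) (Equiv.prodAssoc _ _ _)) =
        ((1 : Matrix (Fin (n + 1)) (Fin (n + 1)) ℂ) ⊗ₖ cgMap A 2) *
          ρ₃.submatrix (Fin.consEquiv fun _ => Fin (n + 1)) (Fin.consEquiv fun _ => Fin (n + 1)) *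
        ((1 : Matrix (Fin (n + 1)) (Fin (n + 1)) ℂ) ⊗ₖ cgMap A 2)ᴴ →
      (∀ k, k + 5 ≤ m' + 2 → traceLeft (ω (k + 5)) =
        (leftMap A ⊗ₖ (1 : Matrix (Fin (n + 1)) (Fin (n + 1)) ℂ)) *
          (ω (k + 4)).submatrix (Equiv.prodAssoc _ _ _) (Equiv.prodAssoc _ _ _) *
        (leftMap A ⊗ₖ (1 : Matrix (Fin (n + 1)) (Fin (n + 1)) ℂ))ᴴ) →
      (∀ k, k + 5 ≤ m' + 2 → traceRight ((ω (k + 5)).submatrix (Equiv.prodAssoc _ _ _) (Equiv.prodAssoc _ _ _)) =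
        ((1 : Matrix (Fin (n + 1)) (Fin (n + 1)) ℂ) ⊗ₖ rightMap A) * ω (k + 4) *
        ((1 : Matrix (Fin (n + 1)) (Fin (n + 1)) ℂ) ⊗ₖ rightMap A)ᴴ) →
      (∀ k, k + 4 ≤ m' + 2 → (ω (k + 4)).PosSemidef) →
      (∀ k, k + 4 ≤ m' + 2 → ∀ i j, cgTag (fun s : Fin (n + 1) => (n : ℤ) - 2 * ((s : ℕ) : ℤ)) qb i ≠
          cgTag (fun s : Fin (n + 1) => (n : ℤ) - 2 * ((s : ℕ) : ℤ)) qb j → ω (k + 4) i j = 0) →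
      (∀ k, k + 4 ≤ m' + 2 → ∀ i j, starRingEnd ℂ (ω (k + 4) i j) = ω (k + 4) i j) →
      (∀ k, k + 4 ≤ m' + 2 → ∀ i j, ‖ω (k + 4) i j‖ ≤ B (k + 4)) →
      E ≤ ((((J : ℂ) • spinDot n (0 : Fin 3) 1) * ρ₃).trace).re) :
    E ≤ heisenbergEnergyDensity n 1 J :=
  lti_primal_energyDensity_ge n m' hJ fun ρ h1 h2 h3 h4 h5 h6 =>
    lti_claim_of_mps_claim n m' hm' J A hAreal qb hAcov B hB hclaim ρ h1 h2 h3 h4 h5 h6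

end Transport

end Summit.Ventures.CertifiedManyBodySolver.Transport
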